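import Summits.Ventures.PercRepro.Night2LocalD3Coloops
import Summits.Ventures.PercRepro.Night2LocalD3ZeroFat
import Summits.Ventures.PercRepro.Night2SixFourReduction

/-!
# PercRepro — many coloops force layer 0 at every `|E ∖ G| ≤ q`; the `(6, 4)` row with small coloop counts (night-2, gen 12)

* **`localShadowHall_of_card_le_kColoops`**: at `|E ∖ G| = d ≤ q`, if `M|G` has at least `d` coloops then every member is
  layer-0 (`kColoops_add_one_le_of_not_lay0`) and the tree's `localShadowHall_of_all_lay0` gives (LI_G) — at `d = q` this is
  gen 9's `card_sdiff_clF_eq_one_of_kColoops`, at `d = 3` the `≥ 3` cell, at `d = 2` the new `≥ 2` cell;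
* **`shadowHall_six_four_of_local_small_k`**: the `(6, 4)` shadow row for EVERY finite matroid, modulo the local form at
  `|E ∖ G| = 2` with `kColoops ≤ 1` and at `|E ∖ G| = 3` with `1 ≤ kColoops ≤ 2`, of loopless simple rank-`6` matroids — the
  exact open set of the row after this generation.
-/

open scoped Matroid

namespace PercRepro.Shadow

open Finset PerFlat ThmH

variable {α : Type*} [DecidableEq α] {M : Matroid α} [M.Finite]

section General

variable {q : ℕ} {G : Finset α}

open scoped Classical in
/-- **At `|E ∖ G| = d ≤ q`, at least `d` coloops of `M|G` leave only layer-0 members, so (LI_G) holds.** -/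
theorem localShadowHall_of_card_le_kColoops (hG : G ∈ flatsQ M (q + 1)) {d : ℕ} (hd : (gr M \ G).card = d)
    (hdq : d ≤ q) (hk : d ≤ kColoops M G) : LocalShadowHall M q G := by
  apply localShadowHall_of_all_lay0 hG (hd ▸ hdq)
  intro B hB
  by_contra hne
  have hB0 : B ∉ lay0 M q G := by
    intro h0
    exact hne (mem_lay0.1 h0).2.1
  have := kColoops_add_one_le_of_not_lay0 hG hd hdq hB hB0
  omega

end General

section SixFour

variable {α' : Type} [DecidableEq α']

/-- **THE `(6, 4)` SHADOW ROW FOR EVERY FINITE MATROID, MODULO `|E ∖ G| = 2` WITH `kColoops ≤ 1` AND `|E ∖ G| = 3` WITH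
`1 ≤ kColoops ≤ 2`** of loopless simple rank-`6` matroids. -/
theorem shadowHall_six_four_of_local_small_k
    (hloc2 : ∀ (N : Matroid α') [N.Finite], (∀ e ∈ gr N, ∀ f ∈ gr N, e ≠ f → rkN N {e, f} = 2) →
      (∀ e ∈ gr N, N.Indep {e}) → N.eRank = ((6 : ℕ) : ℕ∞) →
      ∀ G ∈ flatsQ N (4 + 1), (gr N \ G).card = 2 → kColoops N G ≤ 1 → LocalShadowHall N 4 G)
    (hloc3 : ∀ (N : Matroid α') [N.Finite], (∀ e ∈ gr N, ∀ f ∈ gr N, e ≠ f → rkN N {e, f} = 2) →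
      (∀ e ∈ gr N, N.Indep {e}) → N.eRank = ((6 : ℕ) : ℕ∞) →
      ∀ G ∈ flatsQ N (4 + 1), (gr N \ G).card = 3 → 1 ≤ kColoops N G → kColoops N G ≤ 2 → LocalShadowHall N 4 G)
    (M : Matroid α') [M.Finite] : ShadowHall M 6 4 (phiK 6 4) := by
  apply shadowHall_six_four_of_local_two_three
  intro N _ hs hl hN G hG h2 h3
  rcases Nat.lt_or_ge (gr N \ G).card 3 with hlt | hge
  · -- `|E ∖ G| = 2`
    have hd : (gr N \ G).card = 2 := by omega
    rcases Nat.lt_or_ge (kColoops N G) 2 with hk | hk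
    · exact hloc2 N hs hl hN G hG hd (by omega)
    · exact localShadowHall_of_card_le_kColoops hG hd (by norm_num) hk
  · -- `|E ∖ G| = 3`
    have hd : (gr N \ G).card = 3 := by omega
    rcases Nat.lt_or_ge (kColoops N G) 1 with h0 | h1
    · exact localShadowHall_d3_zero hs hl hG hd (by omega)
    · rcases Nat.lt_or_ge (kColoops N G) 3 with hk2 | hk3
      · exact hloc3 N hs hl hN G hG hd h1 (by omega)
      · exact localShadowHall_of_card_le_kColoops hG hd (by norm_num) hk3

end SixFour

end PercRepro.Shadow
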